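import Mathlib
import Summits.ValiantsHypothesis.ValiantsHypothesis.Theorems.FeketeSOSCharPSparseSOSSumCliqueCompletion

/-!
# Crux `FeketeSOS.CharPSparseSOS` (stmt-ValiantsHypothesis-14989) — what PARITY gives on the
sum-clique core (CORE): near-extremal weak-Sidon Paley sum-cliques are anti-diagonal

The fourth classical tool on restricted Paley sum-cliques `Q ⊆ 𝔽_p` (`a + b ∈ QR` for `a ≠ b` in `Q`,
the diagonal `2a` free), after counting, Stepanov/Hanson–Petridis (`sumClique_card_mul_card_good_le`,
p139743) and completion (`sumClique_completion_bound`, p140731), is PARITY — the device behind the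
Bachoc–Matolcsi–Ruzsa / Shkredov bound `|A|² + |A| − 1 ≤ p` for Paley DIFFERENCE-cliques (Shkredov,
*Sumsets in quadratic residues*, Acta Arith. 164 (2014), Lemma 8 and Thm 9; arXiv:1305.4093).  With
`Λ_Q(x) := Σ_{b ∈ Q} χ(x + b)` one has `Λ_Q(x) ≡ |Q| − [−x ∈ Q] (mod 2)` (`scp_two_dvd_charTranslate`:
`χ` is odd-valued off `0`), and an EVEN integer `v` has `v² + 2v ≥ 0` (an odd one only `≥ −1`).  Since
`Σ_x Λ_Q(x) = 0` and, on a restricted sum-clique, `Λ_Q(a) = (|Q| − 1) + χ(2a)` for `a ∈ Q`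
(`sumClique_charTranslate_eq`), summing `Λ² + 2Λ ≥ −[parity defect]` over `x ∉ Q` against the exact
outside energy (`sumClique_outsideEnergy_eq`) DOUBLES the weight of the linear term that completion alone
sees.  Results (`q = |Q|`, `Q⁺ = {a ∈ Q : (2a|p) = 1}` the good-diagonal class):

* `sumClique_parity_even_sum` / `sumClique_parity_odd_sum` — the summed inequalities
  `Σ_{a∈Q} (((q−1)+χ(2a))² + 2((q−1)+χ(2a))) ≤ q(p − q) + q` (`q` even), `≤ q(p − q) + (p − 2q + 1)` (`q` odd);
* `sumClique_parity_even` — **`4·#Q⁺ + q² ≤ p + q + 1`** for every restricted sum-clique of EVEN size;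
* `sumClique_parity_odd` — **`4q·#Q⁺ + q(q² − q + 2) ≤ (q + 1)p + 1`** for ODD size.

READING.  (i) Without any Sidon hypothesis an even restricted sum-clique has `q² − q − 1 ≤ p` — the
weak-Sidon COUNTING level `C(q,2) ≤ (p−1)/2`, sharper than completion's `(q − 2)² + q ≤ p` by `2q − 5`.
(ii) For a weak-Sidon sum-clique with deficiency `m := (p−1)/2 − C(q,2)` (so `p = q² − q + 1 + 2m`) the even
bound reads `2·#Q⁺ ≤ m + 1` and the odd one `#Q⁺ ≤ q/4 + m/2 + (m+1)/(2q) − 1/2`: a near-counting-extremal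
weak-Sidon sum-clique is anti-diagonal up to `(m+1)/2` (resp. `≈ q/4 + m/2`) points — in the exact case
`m = 0`, `q` even, the good class is EMPTY (`p = 13`, `Q = {0,1,3,9}`: `2Q = {0,2,6,5} ⊆ {0} ∪ NQR`).  So the
residual configuration of (CORE) / of its first open case `CoreSumCliqueOneNotch` (crux NOTES §Q.2, §R.2,
STRATEGY-CENSUS §0) is, with one more classical tool spent and quantified, an (almost) PURELY anti-diagonal
weak-Sidon sum-clique `T` (`T +̂ T ⊆ QR`, `2·T ⊆ NQR`) of size `≥ q − (m+1)/2`; on such `T` parity, like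
completion and Stepanov, is tautological.  (Lead c6 of the crux; `--supports`.)
-/

-- `Summit.ValiantsHypothesis.ValiantsHypothesis.…` is the tree's mandated single-conjunct layout (Sub = Summit).
set_option linter.dupNamespace false

namespace Summit.ValiantsHypothesis.ValiantsHypothesis.Theorems.CharPSparseSOSTwoCusp

open Finset

/-! ## Parity of the character translate `Λ_Q(x) = Σ_{b∈Q} χ(x + b)` -/

/-- `χ(y) − 1 + [y = 0]` is even: the quadratic character takes odd values off `0`. -/
theorem scp_two_dvd_quadraticChar {p : ℕ} [Fact p.Prime] (y : ZMod p) :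
    (2 : ℤ) ∣ quadraticChar (ZMod p) y - 1 + (if y = 0 then 1 else 0) := by
  by_cases hy : y = 0
  · rw [if_pos hy, hy, quadraticChar_zero]; norm_num
  · rw [if_neg hy, add_zero]
    rcases quadraticChar_dichotomy hy with h | h <;> rw [h] <;> norm_num

/-- **Parity of `Λ_Q`**: `Λ_Q(x) ≡ |Q| − [−x ∈ Q] (mod 2)` for every `Q ⊆ 𝔽_p` and every `x`. -/
theorem scp_two_dvd_charTranslate {p : ℕ} [Fact p.Prime] (Q : Finset (ZMod p)) (x : ZMod p) :
    (2 : ℤ) ∣ (∑ b ∈ Q, quadraticChar (ZMod p) (x + b)) - Q.card + (if -x ∈ Q then 1 else 0) := by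
  have h : (2 : ℤ) ∣ ∑ b ∈ Q, (quadraticChar (ZMod p) (x + b) - 1 + (if x + b = 0 then 1 else 0)) :=
    Finset.dvd_sum fun b _ => scp_two_dvd_quadraticChar (x + b)
  have hind : (∑ b ∈ Q, (if x + b = 0 then (1 : ℤ) else 0)) = if -x ∈ Q then 1 else 0 := by
    have key : ∀ b ∈ Q, (if x + b = 0 then (1 : ℤ) else 0) = if b = -x then 1 else 0 := by
      intro b _
      have hiff : x + b = 0 ↔ b = -x := by
        constructor
        · intro hb; linear_combination hb
        · intro hb; rw [hb, add_neg_cancel]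
      simp only [hiff]
    rw [Finset.sum_congr rfl key, Finset.sum_ite_eq' Q (-x) (fun _ => (1 : ℤ))]
  have hsplit : (∑ b ∈ Q, (quadraticChar (ZMod p) (x + b) - 1 + (if x + b = 0 then (1 : ℤ) else 0))) =
      (∑ b ∈ Q, quadraticChar (ZMod p) (x + b)) - Q.card + (if -x ∈ Q then 1 else 0) := by
    rw [Finset.sum_add_distrib, Finset.sum_sub_distrib, hind, Finset.sum_const, nsmul_eq_mul, mul_one]
  rwa [hsplit] at h

/-- An even integer `v` has `v² + 2v = v(v + 2) ≥ 0`. -/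
theorem scp_sq_add_two_mul_nonneg (v : ℤ) (h : (2 : ℤ) ∣ v) : 0 ≤ v ^ 2 + 2 * v := by
  obtain ⟨w, rfl⟩ := h
  have hw : 0 ≤ w * (w + 1) := by
    rcases le_or_gt 0 w with hw | hw
    · exact mul_nonneg hw (by linarith)
    · exact mul_nonneg_of_nonpos_of_nonpos hw.le (by linarith)
  nlinarith [hw]

/-- Every integer `v` has `v² + 2v = (v + 1)² − 1 ≥ −1`. -/
theorem scp_sq_add_two_mul_ge (v : ℤ) : -1 ≤ v ^ 2 + 2 * v := by
  nlinarith [sq_nonneg (v + 1)]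

/-- `Σ_x Λ_Q(x) = 0` (each translate of `χ` sums to zero). -/
theorem scp_sum_charTranslate_univ {p : ℕ} [Fact p.Prime] (hp2 : p ≠ 2) (Q : Finset (ZMod p)) :
    ∑ x : ZMod p, ∑ b ∈ Q, quadraticChar (ZMod p) (x + b) = 0 := by
  rw [Finset.sum_comm]
  refine Finset.sum_eq_zero fun b _ => ?_
  have hchar : ringChar (ZMod p) ≠ 2 := by rwa [ZMod.ringChar_zmod_n]
  rw [← quadraticChar_sum_zero hchar]
  exact Fintype.sum_equiv (Equiv.addRight b) _ _ (fun x => rfl)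

/-- Pointwise parity bound, even size: if `|Q|` is even and `−x ∉ Q` then `Λ_Q(x)` is even, so
`Λ_Q(x)² + 2Λ_Q(x) ≥ 0`. -/
theorem scp_pointwise_even {p : ℕ} [Fact p.Prime] (Q : Finset (ZMod p)) (heven : Even Q.card)
    (x : ZMod p) (hx : -x ∉ Q) :
    0 ≤ (∑ b ∈ Q, quadraticChar (ZMod p) (x + b)) ^ 2 + 2 * ∑ b ∈ Q, quadraticChar (ZMod p) (x + b) := by
  have hdvd := scp_two_dvd_charTranslate Q x
  rw [if_neg hx, add_zero] at hdvd
  have hq : (2 : ℤ) ∣ (Q.card : ℤ) := by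
    obtain ⟨r, hr⟩ := heven
    exact ⟨r, by rw [hr]; push_cast; ring⟩
  have h2 : (2 : ℤ) ∣ ∑ b ∈ Q, quadraticChar (ZMod p) (x + b) := by
    have := dvd_add hdvd hq
    rwa [sub_add_cancel] at this
  exact scp_sq_add_two_mul_nonneg _ h2

/-- Pointwise parity bound, odd size: if `|Q|` is odd and `−x ∈ Q` then `Λ_Q(x)` is even, so
`Λ_Q(x)² + 2Λ_Q(x) ≥ 0`. -/
theorem scp_pointwise_odd {p : ℕ} [Fact p.Prime] (Q : Finset (ZMod p)) (hodd : Odd Q.card)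
    (x : ZMod p) (hx : -x ∈ Q) :
    0 ≤ (∑ b ∈ Q, quadraticChar (ZMod p) (x + b)) ^ 2 + 2 * ∑ b ∈ Q, quadraticChar (ZMod p) (x + b) := by
  have hdvd := scp_two_dvd_charTranslate Q x
  rw [if_pos hx] at hdvd
  have hq : (2 : ℤ) ∣ (Q.card : ℤ) - 1 := by
    obtain ⟨r, hr⟩ := hodd
    exact ⟨r, by rw [hr]; push_cast; ring⟩
  have h2 : (2 : ℤ) ∣ ∑ b ∈ Q, quadraticChar (ZMod p) (x + b) := by
    have := dvd_add hdvd hq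
    rwa [show (∑ b ∈ Q, quadraticChar (ZMod p) (x + b)) - Q.card + 1 + ((Q.card : ℤ) - 1) =
      ∑ b ∈ Q, quadraticChar (ZMod p) (x + b) by ring] at this
  exact scp_sq_add_two_mul_nonneg _ h2

/-! ## Counting the parity-defect sets `{x ∉ Q : −x ∈ Q}` and `{x ∉ Q : −x ∉ Q}` -/

/-- At most `|Q|` points `x ∉ Q` have `−x ∈ Q`. -/
theorem scp_card_compl_neg_mem_le {p : ℕ} [Fact p.Prime] (Q : Finset (ZMod p)) :
    ((Finset.univ \ Q).filter (fun x => -x ∈ Q)).card ≤ Q.card := by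
  refine Finset.card_le_card_of_injOn (fun x => -x) ?_ ?_
  · intro x hx
    rw [Finset.mem_coe, Finset.mem_filter] at hx
    exact Finset.mem_coe.2 hx.2
  · intro x _ y _ hxy
    exact neg_injective hxy

/-- `(2 : ZMod p) ≠ 0` for an odd prime `p`. -/
theorem scp_two_ne_zero {p : ℕ} [Fact p.Prime] (hp2 : p ≠ 2) : (2 : ZMod p) ≠ 0 := by
  have hp : p.Prime := Fact.out
  intro h
  have hdvd : p ∣ 2 := (ZMod.natCast_eq_zero_iff 2 p).1 (by exact_mod_cast h)
  have hle : p ≤ 2 := Nat.le_of_dvd two_pos hdvd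
  have h2 : 2 ≤ p := hp.two_le
  omega

/-- On a restricted sum-clique, at least `|Q| − 1` points `x ∉ Q` have `−x ∈ Q`: the points `−y`,
`y ∈ Q ∖ {0}` (`y` and `−y` cannot both lie in `Q` unless `y = 0`, since `χ(y + (−y)) = χ(0) ≠ 1`). -/
theorem scp_card_le_card_compl_neg_mem_add_one {p : ℕ} [Fact p.Prime] (hp2 : p ≠ 2)
    (Q : Finset (ZMod p)) (hclique : ∀ a ∈ Q, ∀ b ∈ Q, a ≠ b → legendreSym p (a + b).val = 1) :
    Q.card ≤ ((Finset.univ \ Q).filter (fun x => -x ∈ Q)).card + 1 := by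
  have h : (Q.erase 0).card ≤ ((Finset.univ \ Q).filter (fun x => -x ∈ Q)).card := by
    refine Finset.card_le_card_of_injOn (fun y => -y) ?_ ?_
    · intro y hy
      rw [Finset.mem_coe, Finset.mem_erase] at hy
      obtain ⟨hy0, hyQ⟩ := hy
      rw [Finset.mem_coe, Finset.mem_filter, Finset.mem_sdiff, neg_neg]
      refine ⟨⟨Finset.mem_univ _, fun hneg => ?_⟩, hyQ⟩
      by_cases hyy : y = -y
      · apply hy0
        have h2 : (2 : ZMod p) * y = 0 := by linear_combination hyy
        exact (mul_eq_zero.1 h2).resolve_left (scp_two_ne_zero hp2)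
      · have := hclique y hyQ (-y) hneg hyy
        rw [add_neg_cancel, ZMod.val_zero, Nat.cast_zero, legendreSym.at_zero] at this
        exact zero_ne_one this
    · intro y _ y' _ h
      exact neg_injective h
  have h2 := Finset.pred_card_le_card_erase (s := Q) (a := 0)
  omega

/-! ## The parity inequalities -/

/-- **Parity, even size (summed form).**  For a restricted Paley sum-clique `Q ⊆ 𝔽_p` of even size `q`:
`Σ_{a∈Q} (((q−1)+χ(2a))² + 2((q−1)+χ(2a))) ≤ q(p − q) + q`.  (Outside `Q`: `Λ² + 2Λ ≥ −[−x ∈ Q]`;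
sum, use `Σ_x Λ = 0`, `Λ(a) = (q−1)+χ(2a)` on `Q`, the exact outside energy and `#{x ∉ Q : −x ∈ Q} ≤ q`.) -/
theorem sumClique_parity_even_sum :
    ∀ (p : ℕ) [Fact p.Prime], p ≠ 2 → ∀ Q : Finset (ZMod p),
      (∀ a ∈ Q, ∀ b ∈ Q, a ≠ b → legendreSym p (a + b).val = 1) → Even Q.card →
      ∑ a ∈ Q, ((((Q.card : ℤ) - 1) + quadraticChar (ZMod p) (a + a)) ^ 2 +
          2 * (((Q.card : ℤ) - 1) + quadraticChar (ZMod p) (a + a))) ≤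
        (Q.card : ℤ) * ((p : ℤ) - Q.card) + Q.card := by
  intro p _ hp2 Q hclique heven
  classical
  have hout := sumClique_outsideEnergy_eq p hp2 Q hclique
  have htot := scp_sum_charTranslate_univ hp2 Q
  rw [← Finset.sum_sdiff (Finset.subset_univ Q)] at htot
  have hin : ∑ a ∈ Q, ∑ b ∈ Q, quadraticChar (ZMod p) (a + b) =
      ∑ a ∈ Q, (((Q.card : ℤ) - 1) + quadraticChar (ZMod p) (a + a)) :=
    Finset.sum_congr rfl fun a ha => sumClique_charTranslate_eq Q hclique ha
  -- pointwise parity bound outside `Q`, summed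
  have hpt : ∀ x ∈ Finset.univ \ Q,
      -(if -x ∈ Q then (1 : ℤ) else 0) ≤
        (∑ b ∈ Q, quadraticChar (ZMod p) (x + b)) ^ 2 + 2 * ∑ b ∈ Q, quadraticChar (ZMod p) (x + b) := by
    intro x _
    by_cases hx : -x ∈ Q
    · rw [if_pos hx]; exact scp_sq_add_two_mul_ge _
    · rw [if_neg hx, neg_zero]; exact scp_pointwise_even Q heven x hx
  have hsum := Finset.sum_le_sum hpt
  rw [Finset.sum_neg_distrib, Finset.sum_boole, Finset.sum_add_distrib, ← Finset.mul_sum] at hsum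
  have hcnt : ((((Finset.univ \ Q).filter (fun x => -x ∈ Q)).card : ℕ) : ℤ) ≤ Q.card := by
    exact_mod_cast scp_card_compl_neg_mem_le Q
  rw [Finset.sum_add_distrib, ← Finset.mul_sum]
  linarith [hout, htot, hin, hsum, hcnt]

/-- **Parity, odd size (summed form).**  For a restricted Paley sum-clique `Q ⊆ 𝔽_p` of odd size `q`:
`Σ_{a∈Q} (((q−1)+χ(2a))² + 2((q−1)+χ(2a))) ≤ q(p − q) + (p − 2q + 1)`.  (Outside `Q`:
`Λ² + 2Λ ≥ −[−x ∉ Q]`, and `#{x ∉ Q : −x ∉ Q} ≤ (p − q) − (q − 1)`.) -/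
theorem sumClique_parity_odd_sum :
    ∀ (p : ℕ) [Fact p.Prime], p ≠ 2 → ∀ Q : Finset (ZMod p),
      (∀ a ∈ Q, ∀ b ∈ Q, a ≠ b → legendreSym p (a + b).val = 1) → Odd Q.card →
      ∑ a ∈ Q, ((((Q.card : ℤ) - 1) + quadraticChar (ZMod p) (a + a)) ^ 2 +
          2 * (((Q.card : ℤ) - 1) + quadraticChar (ZMod p) (a + a))) ≤
        (Q.card : ℤ) * ((p : ℤ) - Q.card) + ((p : ℤ) - 2 * Q.card + 1) := by
  intro p _ hp2 Q hclique hodd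
  classical
  have hout := sumClique_outsideEnergy_eq p hp2 Q hclique
  have htot := scp_sum_charTranslate_univ hp2 Q
  rw [← Finset.sum_sdiff (Finset.subset_univ Q)] at htot
  have hin : ∑ a ∈ Q, ∑ b ∈ Q, quadraticChar (ZMod p) (a + b) =
      ∑ a ∈ Q, (((Q.card : ℤ) - 1) + quadraticChar (ZMod p) (a + a)) :=
    Finset.sum_congr rfl fun a ha => sumClique_charTranslate_eq Q hclique ha
  have hpt : ∀ x ∈ Finset.univ \ Q,
      -(if ¬ (-x ∈ Q) then (1 : ℤ) else 0) ≤
        (∑ b ∈ Q, quadraticChar (ZMod p) (x + b)) ^ 2 + 2 * ∑ b ∈ Q, quadraticChar (ZMod p) (x + b) := by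
    intro x _
    by_cases hx : -x ∈ Q
    · rw [if_neg (not_not.2 hx), neg_zero]; exact scp_pointwise_odd Q hodd x hx
    · rw [if_pos hx]; exact scp_sq_add_two_mul_ge _
  have hsum := Finset.sum_le_sum hpt
  rw [Finset.sum_neg_distrib, Finset.sum_boole, Finset.sum_add_distrib, ← Finset.mul_sum] at hsum
  -- `#{x ∉ Q : −x ∉ Q} = (p − q) − #{x ∉ Q : −x ∈ Q} ≤ (p − q) − (q − 1)`
  have hsplit := Finset.card_filter_add_card_filter_not
    (s := Finset.univ \ Q) (p := fun x => -x ∈ Q)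
  have hU : (Finset.univ \ Q).card = p - Q.card := by
    rw [Finset.card_univ_sdiff, ZMod.card]
  have hQle : Q.card ≤ p := by
    calc Q.card ≤ (Finset.univ : Finset (ZMod p)).card := Finset.card_le_univ Q
      _ = p := by rw [Finset.card_univ, ZMod.card]
  have hge := scp_card_le_card_compl_neg_mem_add_one hp2 Q hclique
  have hcnt : ((((Finset.univ \ Q).filter (fun x => ¬ (-x ∈ Q))).card : ℕ) : ℤ) ≤
      (p : ℤ) - 2 * Q.card + 1 := by
    have h1 : ((Finset.univ \ Q).filter (fun x => ¬ (-x ∈ Q))).card + Q.card ≤ p - Q.card + 1 := by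
      omega
    have h2 : (((((Finset.univ \ Q).filter (fun x => ¬ (-x ∈ Q))).card + Q.card : ℕ)) : ℤ) ≤
        ((p - Q.card + 1 : ℕ) : ℤ) := by exact_mod_cast h1
    push_cast [Nat.cast_sub hQle] at h2
    linarith
  rw [Finset.sum_add_distrib, ← Finset.mul_sum]
  linarith [hout, htot, hin, hsum, hcnt]

/-- Class-resolved lower bound for the inside sum: a good-diagonal point (`(2a|p) = 1`) contributes
`q² + 2q`, every other point at least `q² − 2q`. -/
theorem scp_inside_sum_ge {p : ℕ} [Fact p.Prime] (Q : Finset (ZMod p)) (hq : 1 ≤ Q.card) :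
    4 * (Q.card : ℤ) * ((Q.filter (fun a => legendreSym p (a + a).val = 1)).card : ℤ) +
        ((Q.card : ℤ) ^ 3 - 2 * (Q.card : ℤ) ^ 2) ≤
      ∑ a ∈ Q, ((((Q.card : ℤ) - 1) + quadraticChar (ZMod p) (a + a)) ^ 2 +
          2 * (((Q.card : ℤ) - 1) + quadraticChar (ZMod p) (a + a))) := by
  classical
  set G := Q.filter (fun a => legendreSym p (a + a).val = 1) with hG
  set q : ℤ := (Q.card : ℤ) with hqdef
  have hq1 : (1 : ℤ) ≤ q := by rw [hqdef]; exact_mod_cast hq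
  rw [← Finset.sum_filter_add_sum_filter_not Q (fun a => legendreSym p (a + a).val = 1)]
  -- good points
  have hgood : ∑ a ∈ G, ((q - 1 + quadraticChar (ZMod p) (a + a)) ^ 2 +
      2 * (q - 1 + quadraticChar (ZMod p) (a + a))) = (G.card : ℤ) * (q ^ 2 + 2 * q) := by
    have : ∀ a ∈ G, ((q - 1 + quadraticChar (ZMod p) (a + a)) ^ 2 +
        2 * (q - 1 + quadraticChar (ZMod p) (a + a))) = q ^ 2 + 2 * q := by
      intro a ha
      rw [hG, Finset.mem_filter] at ha
      rw [← legendreSym_val_eq_quadraticChar, ha.2]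
      ring
    rw [Finset.sum_congr rfl this, Finset.sum_const, nsmul_eq_mul]
  -- other points: `χ(2a) ∈ {−1, 0}` and the term is `≥ q² − 2q`
  have hbad : ∀ a ∈ Q.filter (fun a => ¬ legendreSym p (a + a).val = 1),
      q ^ 2 - 2 * q ≤ (q - 1 + quadraticChar (ZMod p) (a + a)) ^ 2 +
        2 * (q - 1 + quadraticChar (ZMod p) (a + a)) := by
    intro a ha
    rw [Finset.mem_filter] at ha
    have hne : quadraticChar (ZMod p) (a + a) ≠ 1 := by
      rw [← legendreSym_val_eq_quadraticChar]; exact ha.2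
    by_cases h0 : a + a = 0
    · rw [h0, quadraticChar_zero]; nlinarith
    · rcases quadraticChar_dichotomy h0 with h | h
      · exact absurd h hne
      · rw [h]; nlinarith
  have hbad_sum := Finset.card_nsmul_le_sum _ _ _ hbad
  rw [nsmul_eq_mul] at hbad_sum
  have hcard : ((Q.filter (fun a => ¬ legendreSym p (a + a).val = 1)).card : ℤ) = q - G.card := by
    have := Finset.card_filter_add_card_filter_not (s := Q)
      (p := fun a => legendreSym p (a + a).val = 1)
    rw [hqdef, ← this, hG]
    push_cast; ring
  rw [hcard] at hbad_sum
  rw [hgood]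
  nlinarith [hbad_sum, hgood, Finset.card_filter_le Q (fun a => legendreSym p (a + a).val = 1)]

/-- **Parity bound, even size.**  Every restricted Paley sum-clique `Q ⊆ 𝔽_p` (`p` an odd prime) of
EVEN size `q` satisfies `4·#Q⁺ + q² ≤ p + q + 1`, where `Q⁺ = {a ∈ Q : (2a|p) = 1}` is the good-diagonal
class.  In particular `q² − q − 1 ≤ p` with no Sidon hypothesis (the weak-Sidon counting level), and for
a weak-Sidon sum-clique with deficiency `m = (p−1)/2 − C(q,2)`: `2·#Q⁺ ≤ m + 1` — near-extremal cliques
are anti-diagonal.  (Bachoc–Matolcsi–Ruzsa / Shkredov parity, transplanted to sum-cliques.) -/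
theorem sumClique_parity_even :
    ∀ (p : ℕ) [Fact p.Prime], p ≠ 2 → ∀ Q : Finset (ZMod p),
      (∀ a ∈ Q, ∀ b ∈ Q, a ≠ b → legendreSym p (a + b).val = 1) → Even Q.card →
      4 * ((Q.filter (fun a => legendreSym p (a + a).val = 1)).card : ℤ) + (Q.card : ℤ) ^ 2 ≤
        (p : ℤ) + Q.card + 1 := by
  intro p hp hp2 Q hclique heven
  classical
  rcases Nat.eq_zero_or_pos Q.card with h0 | hpos
  · have hG : (Q.filter (fun a => legendreSym p (a + a).val = 1)).card = 0 := by
      rw [Finset.card_eq_zero] at h0 ⊢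
      rw [h0]; rfl
    rw [hG, h0]; push_cast; positivity
  · have h1 := sumClique_parity_even_sum p hp2 Q hclique heven
    have h2 := scp_inside_sum_ge Q hpos
    have hq1 : (1 : ℤ) ≤ Q.card := by exact_mod_cast hpos
    -- `4 q #Q⁺ + q³ − 2q² ≤ q(p − q) + q`; divide by `q ≥ 1`
    have hGle : ((Q.filter (fun a => legendreSym p (a + a).val = 1)).card : ℤ) ≤ Q.card := by
      exact_mod_cast Finset.card_filter_le Q _
    nlinarith [h1, h2, hq1, hGle]

/-- **Parity bound, odd size.**  Every restricted Paley sum-clique `Q ⊆ 𝔽_p` (`p` an odd prime) of ODD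
size `q` satisfies `4q·#Q⁺ + q(q² − q + 2) ≤ (q + 1)p + 1`, `Q⁺` the good-diagonal class.  For a
weak-Sidon sum-clique with deficiency `m` (`(q+1)p = q³ + 2mq + 2m + 1`) this reads
`4q·#Q⁺ ≤ q² − 2q + 2mq + 2m + 2`, i.e. `#Q⁺ ≤ q/4 + m/2 + (m+1)/(2q) − 1/2`. -/
theorem sumClique_parity_odd :
    ∀ (p : ℕ) [Fact p.Prime], p ≠ 2 → ∀ Q : Finset (ZMod p),
      (∀ a ∈ Q, ∀ b ∈ Q, a ≠ b → legendreSym p (a + b).val = 1) → Odd Q.card →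
      4 * (Q.card : ℤ) * ((Q.filter (fun a => legendreSym p (a + a).val = 1)).card : ℤ) +
          (Q.card : ℤ) * ((Q.card : ℤ) ^ 2 - Q.card + 2) ≤
        ((Q.card : ℤ) + 1) * p + 1 := by
  intro p hp hp2 Q hclique hodd
  classical
  have hpos : 1 ≤ Q.card := by obtain ⟨k, hk⟩ := hodd; omega
  have h1 := sumClique_parity_odd_sum p hp2 Q hclique hodd
  have h2 := scp_inside_sum_ge Q hpos
  nlinarith [h1, h2]

end Summit.ValiantsHypothesis.ValiantsHypothesis.Theorems.CharPSparseSOSTwoCusp
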